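import Summits.QuantumAdvantage.QuantumAdvantage.Theorems.LightDialC2

/-! # LightDialC3 — part C3 — the witness on one-minority inputs, splits `(2,1)`/`(4,1)`, assembly: `¬ LightFail 2 3`

NODE «LightDial» (decomp-qadv lens-2 g26) — the PREDECESSOR WITNESS `predW_b(x) = E_b + 2·E_b·O_b + 2·x_{b+1} (mod 3)` (`E_b/O_b` = number
of ones at the positions of the same / the other parity as `b`, even ring): an explicit rotation-covariant QUADRATIC strategy that is perfect on
every odd-class input of Hamming weight `≤ 5` at every even length — so `¬ LightFail 2 3` and `¬ LightFail 2 5` are THEOREMS (parts C3, C5) and the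
law-bet piece `LightFail 2 w → NoPerfectTwo3` of the dial (Theorems.LightDialA/B) is to be read at `w ≥ 7` (numerically the threshold is exactly 7:
g26 `num/Q-STRUCTURE.md`, critic 69v66). Five files C1 → … → C5 (gate form ≤ 400 lines each); rung 0, nothing here bears on 27432 itself.

THIS FILE: §12 (second half): the witness's answers on a one-minority input (`predAns_of_par_eq/…_ne_two/…_ne_four`), `rel_of_four` (`(4,1)`), the rank
pairing `card_oddRank_eq_one` and `rel_of_two` (`(2,1)`); §13 parity counts `parCount`, ★★ `predWPerfect_three`, ★★ `not_lightFail_two_three :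
¬ LightFail 2 3` (THEOREM), the typed `(3,2)` residual `Pred32Law n` and `not_lightFail_two_five_of_law32` (discharged in part C5).
-/

set_option linter.dupNamespace false
set_option linter.unnecessarySeqFocus false
noncomputable section
open scoped Classical

namespace Summit.QuantumAdvantage.QuantumAdvantage.Theorems.LightDial
open Finset
open Literature.Computability.QuantumComplexity Literature.Computability.QuantumComplexity.RingHLF
open Literature.Computability.MetaComplexity Literature.Computability.MetaComplexity.Smolensky
open Summit.QuantumAdvantage.AdviceFreeQNC0
open Summit.QuantumAdvantage.QuantumAdvantage.Theorems.RingPeriodFold (kvec kernel_pair_of_oddZeros kvec_ne_zero rel_iff_of_kernel_pair)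

variable {n : ℕ}

namespace OneMinority
variable {x : Fin n → Bool} {p : ℕ} {c : Fin n}

/-! ### the witness's answers on a one-minority input -/

/-- class counts seen from a majority-parity output … -/
theorem ecnt_of_par_eq {b : Fin n} (hb : par b = p) :
    ecnt b x = (univ.filter fun i : Fin n => x i = true ∧ par i = p).card := by
  unfold ecnt; rw [hb]

/-- … a majority-parity output sees exactly one one of the other parity (`c`). -/
theorem ocnt_of_par_eq (h : OneMinority x p c) {b : Fin n} (hb : par b = p) : ocnt b x = 1 := by
  unfold ocnt; rw [hb, Finset.card_eq_one]
  refine ⟨c, ?_⟩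
  ext i; simp only [mem_filter, mem_univ, true_and, mem_singleton]
  constructor
  · rintro ⟨hi, hpi⟩; exact h.eq_c_of_one hi hpi
  · rintro rfl; exact ⟨h.hc, h.hpc⟩

/-- … and from a minority-parity output. -/
theorem ecnt_of_par_ne (h : OneMinority x p c) {b : Fin n} (hb : par b ≠ p) : ecnt b x = 1 := by
  have hb2 := par_lt_two b; have hc2 := par_lt_two c; have hpc := h.hpc; have hp2 := h.hp2
  unfold ecnt; rw [Finset.card_eq_one]
  refine ⟨c, ?_⟩
  ext i; simp only [mem_filter, mem_univ, true_and, mem_singleton]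
  constructor
  · rintro ⟨hi, hpi⟩; exact h.eq_c_of_one hi (by omega)
  · rintro rfl; exact ⟨h.hc, by omega⟩

/-- … and a minority-parity output sees all `k` majority ones as the other parity. -/
theorem ocnt_of_par_ne (h : OneMinority x p c) {b : Fin n} (hb : par b ≠ p) :
    ocnt b x = (univ.filter fun i : Fin n => x i = true ∧ par i = p).card := by
  have hb2 := par_lt_two b; have hp2 := h.hp2
  unfold ocnt; congr 1; ext i; simp only [mem_filter, mem_univ, true_and]
  have hi2 := par_lt_two i
  constructor
  · rintro ⟨hi, hpi⟩
    refine ⟨hi, ?_⟩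
    by_contra hne; exact hpi (by have := h.eq_c_of_one hi hne; subst this; omega)
  · rintro ⟨hi, hpi⟩; exact ⟨hi, by omega⟩

/-- `3k ≡ 0`: a majority-parity output of the witness is `2·x_{b+1} ≠ 1` (any `k`). -/
theorem predAns_of_par_eq (h : OneMinority x p c) {b : Fin n} (hb : par b = p) : predAns x b = false := by
  have hval : predW b x = 2 * (if x (nxt b) = true then 1 else 0) := by
    unfold predW; rw [ecnt_of_par_eq hb, h.ocnt_of_par_eq hb]
    set k := (univ.filter fun i : Fin n => x i = true ∧ par i = p).card
    have h3 : (k : ZMod 3) + 2 * (k : ZMod 3) * ((1 : ℕ) : ZMod 3) = 0 := by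
      have : (k : ZMod 3) + 2 * (k : ZMod 3) * ((1 : ℕ) : ZMod 3) = ((3 * k : ℕ) : ZMod 3) := by push_cast; ring
      rw [this, Nat.cast_mul]
      have h30 : ((3 : ℕ) : ZMod 3) = 0 := by decide
      rw [h30, zero_mul]
    rw [h3, zero_add]
  simp only [predAns, hval]
  by_cases ht : x (nxt b) = true
  · rw [if_pos ht]; decide
  · rw [if_neg ht]; decide

/-- split `(2,1)`: a minority-parity output is `5 + 2·x_{b+1}`, i.e. the answer bit is `x_{b+1}` (the PREDECESSOR rule). -/
theorem predAns_of_par_ne_two (h : OneMinority x p c) (hk : (univ.filter fun i : Fin n => x i = true ∧ par i = p).card = 2)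
    {b : Fin n} (hb : par b ≠ p) : predAns x b = x (nxt b) := by
  have hval : predW b x = ((1 : ℕ) : ZMod 3) + 2 * ((1 : ℕ) : ZMod 3) * ((2 : ℕ) : ZMod 3) + 2 * (if x (nxt b) = true then 1 else 0) := by
    unfold predW; rw [h.ecnt_of_par_ne hb, h.ocnt_of_par_ne hb, hk]
  simp only [predAns, hval]
  by_cases ht : x (nxt b) = true
  · rw [if_pos ht, ht]; decide
  · rw [if_neg ht, Bool.eq_false_iff.mpr ht]; decide

/-- split `(4,1)`: a minority-parity output is `9 + 2·x_{b+1} ≠ 1`. -/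
theorem predAns_of_par_ne_four (h : OneMinority x p c) (hk : (univ.filter fun i : Fin n => x i = true ∧ par i = p).card = 4)
    {b : Fin n} (hb : par b ≠ p) : predAns x b = false := by
  have hval : predW b x = 2 * (if x (nxt b) = true then 1 else 0) := by
    unfold predW; rw [h.ecnt_of_par_ne hb, h.ocnt_of_par_ne hb, hk]
    have h9 : ((1 : ℕ) : ZMod 3) + 2 * ((1 : ℕ) : ZMod 3) * ((4 : ℕ) : ZMod 3) = 0 := by decide
    rw [h9, zero_add]
  simp only [predAns, hval]
  by_cases ht : x (nxt b) = true
  · rw [if_pos ht]; decide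
  · rw [if_neg ht]; decide

/-- ★ split `(4,1)` DONE: the witness answers nothing, and the sign bit is `0`. -/
theorem rel_of_four (h : OneMinority x p c) (hx : OddZeros x)
    (hk : (univ.filter fun i : Fin n => x i = true ∧ par i = p).card = 4) : Rel x (predAns x) := by
  have hK := kernel_pair_of_oddZeros h.three hx
  rw [rel_iff_of_kernel_pair x (kvec x) _ hK, h.kvec_eq_cntVec hx, h.signBit_cntVec, hk]
  have hz : predAns x = fun _ => false := by
    funext b
    by_cases hb : par b = p
    · exact h.predAns_of_par_eq hb
    · exact h.predAns_of_par_ne_four hk hb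
  rw [hz]; simp [dot2]

/-! ### split `(2,1)`: exactly one of the two predecessors lies in the kernel vector -/

/-- the unrolled count just before a majority one equals the count AT it (the position in between has the wrong parity). -/
theorem cnt_toff_prv (h : OneMinority x p c) {a : Fin n} (hpa : par a = p) :
    cnt x p c (toff c (prv a)) = cnt x p c (toff c a) := by
  have hac : a ≠ c := fun e => h.hpc (e ▸ hpa)
  have ht0 : toff c a ≠ 0 := fun e => hac ((toff_eq_zero_iff c a).mp e)
  rw [toff_prv, if_neg ht0]
  have e1 : toff c a = (toff c a - 1) + 1 := by omega
  conv_rhs => rw [e1, cnt_succ]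
  rw [card_at_eq_zero, Nat.add_zero]
  intro i hi ⟨_, hip⟩
  have m1 := toff_mod_two h.even c i; have m2 := toff_mod_two h.even c a; have hp2 := h.hp2
  unfold par at *; omega

/-- the positions where the `(2,1)` answer meets the kernel vector are the predecessors of the majority ones of odd rank. -/
theorem filter_dot_eq_image (h : OneMinority x p c) (hk : (univ.filter fun i : Fin n => x i = true ∧ par i = p).card = 2) :
    (univ.filter fun b : Fin n => cntVec x p c b = true ∧ predAns x b = true) =
      (univ.filter fun a : Fin n => x a = true ∧ par a = p ∧ cnt x p c (toff c a) % 2 = 1).image prv := by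
  ext b; simp only [mem_filter, mem_univ, true_and, mem_image]
  have hpn := par_nxt h.even b; have hb2 := par_lt_two b; have hp2 := h.hp2
  constructor
  · rintro ⟨hV, hz⟩
    have hb : par b ≠ p := by
      intro hb; rw [h.predAns_of_par_eq hb] at hz; exact Bool.false_ne_true hz
    rw [h.predAns_of_par_ne_two hk hb] at hz
    have hn' : par (nxt b) = p := by unfold par at *; omega
    refine ⟨nxt b, ⟨hz, hn', ?_⟩, prv_nxt b⟩
    rw [← h.cnt_toff_prv hn', prv_nxt]
    simpa [cntVec, hb] using hV
  · rintro ⟨a, ⟨ha, hpa, hodd⟩, rfl⟩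
    have hpp := par_prv h.even a; have ha2 := par_lt_two a
    have hb : par (prv a) ≠ p := by unfold par at *; omega
    refine ⟨?_, ?_⟩
    · simp only [cntVec, hb, if_false, decide_eq_true_eq]; rw [h.cnt_toff_prv hpa]; exact hodd
    · rw [h.predAns_of_par_ne_two hk hb, nxt_prv]; exact ha

/-- with exactly two majority ones, exactly ONE of them has odd rank (the later one clockwise from `c`). -/
theorem card_oddRank_eq_one (hk : (univ.filter fun i : Fin n => x i = true ∧ par i = p).card = 2) :
    (univ.filter fun a : Fin n => x a = true ∧ par a = p ∧ cnt x p c (toff c a) % 2 = 1).card = 1 := by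
  obtain ⟨a1, a2, hne, hA⟩ := Finset.card_eq_two.mp hk
  have hmem : ∀ i : Fin n, (x i = true ∧ par i = p) ↔ (i = a1 ∨ i = a2) := by
    intro i
    have := Finset.ext_iff.mp hA i
    simpa [mem_filter] using this
  -- the rank of a majority one = number of majority ones strictly before it
  have hrank : ∀ a : Fin n, cnt x p c (toff c a) =
      (({a1, a2} : Finset (Fin n)).filter fun i => toff c i < toff c a).card := by
    intro a; unfold cnt; congr 1; ext i
    simp only [mem_filter, mem_univ, true_and, mem_insert, mem_singleton]
    constructor
    · rintro ⟨h1, h2, h3⟩; exact ⟨(hmem i).mp ⟨h1, h2⟩, h3⟩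
    · rintro ⟨h12, h3⟩; obtain ⟨h1, h2⟩ := (hmem i).mpr h12; exact ⟨h1, h2, h3⟩
  have ht : toff c a1 ≠ toff c a2 := fun e => hne (toff_injective c e)
  have hr1 : cnt x p c (toff c a1) = if toff c a2 < toff c a1 then 1 else 0 := by
    rw [hrank, Finset.filter_insert, if_neg (lt_irrefl _), Finset.filter_singleton]
    split_ifs <;> simp
  have hr2 : cnt x p c (toff c a2) = if toff c a1 < toff c a2 then 1 else 0 := by
    rw [hrank, Finset.filter_insert, Finset.filter_singleton, if_neg (lt_irrefl _)]
    split_ifs <;> simp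
  have hset : (univ.filter fun a : Fin n => x a = true ∧ par a = p ∧ cnt x p c (toff c a) % 2 = 1) =
      ({a1, a2} : Finset (Fin n)).filter fun a => cnt x p c (toff c a) % 2 = 1 := by
    ext i; simp only [mem_filter, mem_univ, true_and, mem_insert, mem_singleton]
    constructor
    · rintro ⟨h1, h2, h3⟩; exact ⟨(hmem i).mp ⟨h1, h2⟩, h3⟩
    · rintro ⟨h12, h3⟩; obtain ⟨h1, h2⟩ := (hmem i).mpr h12; exact ⟨h1, h2, h3⟩
  rw [hset, Finset.filter_insert, Finset.filter_singleton, hr1, hr2]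
  rcases lt_trichotomy (toff c a1) (toff c a2) with hlt | heq | hgt
  · have h21 : ¬ toff c a2 < toff c a1 := not_lt.mpr hlt.le
    simp [hlt, h21]
  · exact absurd heq ht
  · have h12 : ¬ toff c a1 < toff c a2 := not_lt.mpr hgt.le
    simp [hgt, h12]

/-- ★ split `(2,1)` DONE: sign bit `1`, and exactly one predecessor inside the kernel vector. -/
theorem rel_of_two (h : OneMinority x p c) (hx : OddZeros x)
    (hk : (univ.filter fun i : Fin n => x i = true ∧ par i = p).card = 2) : Rel x (predAns x) := by
  have hK := kernel_pair_of_oddZeros h.three hx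
  rw [rel_iff_of_kernel_pair x (kvec x) _ hK, h.kvec_eq_cntVec hx, h.signBit_cntVec, hk]
  unfold dot2
  rw [h.filter_dot_eq_image hk, Finset.card_image_of_injective _ prv_injective, card_oddRank_eq_one hk]

end OneMinority

/-! ## §13 Assembly: weight ≤ 3 unconditionally, weight ≤ 5 from the `(3,2)` law -/

/-- number of ones of parity `q`. -/
def parCount (x : Fin n → Bool) (q : ℕ) : ℕ := (univ.filter fun i : Fin n => x i = true ∧ par i = q).card

/-- the two parity counts add up to the weight. -/
theorem parCount_add (x : Fin n → Bool) : parCount x 0 + parCount x 1 = wt x := by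
  unfold parCount wt
  have hsplit := Finset.card_filter_add_card_filter_not (s := univ.filter fun i : Fin n => x i = true)
    (fun i : Fin n => par i = 0)
  rw [Finset.filter_filter, Finset.filter_filter] at hsplit
  have e : (univ.filter fun i : Fin n => x i = true ∧ ¬ par i = 0) = univ.filter fun i : Fin n => x i = true ∧ par i = 1 := by
    congr 1; ext i; have := par_lt_two i; constructor
    · rintro ⟨h1, h2⟩; exact ⟨h1, by omega⟩
    · rintro ⟨h1, h2⟩; exact ⟨h1, by omega⟩
  rw [e] at hsplit; exact hsplit

/-- on an even ring the odd class consists of the inputs of odd weight. -/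
theorem wt_mod_two_of_oddZeros (hn : Even n) {x : Fin n → Bool} (hx : OddZeros x) : wt x % 2 = 1 := by
  have hsplit := Finset.card_filter_add_card_filter_not (s := (univ : Finset (Fin n))) (fun i : Fin n => x i = false)
  have e : (univ.filter fun i : Fin n => ¬ x i = false) = univ.filter fun i : Fin n => x i = true := by
    congr 1; ext i; simp
  rw [e, Finset.card_univ, Fintype.card_fin] at hsplit
  unfold OddZeros at hx; unfold wt
  obtain ⟨m, hm⟩ := hn; omega

/-- no ones of parity `q`: the input is single-parity. -/
theorem sameParity_of_parCount_eq_zero {x : Fin n → Bool} {q : ℕ} (hq : q < 2) (h0 : parCount x q = 0) :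
    ∀ j k, x j = true → x k = true → par j = par k := by
  unfold parCount at h0
  rw [Finset.card_eq_zero, Finset.filter_eq_empty_iff] at h0
  intro j k hj hk
  have hj' := h0 (mem_univ j); have hk' := h0 (mem_univ k)
  have := par_lt_two j; have := par_lt_two k
  simp only [hj, hk, true_and] at hj' hk'
  omega

/-- exactly one one of parity `q` and an even number of the other parity: a one-minority configuration. -/
theorem oneMinority_of_parCount_eq_one (hn : Even n) (h3 : 3 ≤ n) {x : Fin n → Bool} {q : ℕ} (hq : q < 2)
    (h1 : parCount x q = 1) (hk : Even (parCount x ((q + 1) % 2))) :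
    ∃ c, OneMinority x ((q + 1) % 2) c := by
  unfold parCount at h1
  obtain ⟨c, hc⟩ := Finset.card_eq_one.mp h1
  have hcm : x c = true ∧ par c = q := by
    have : c ∈ univ.filter fun i : Fin n => x i = true ∧ par i = q := by rw [hc]; exact mem_singleton_self c
    simpa using this
  refine ⟨c, ⟨hn, h3, hcm.1, by omega, fun j hj hjc => ?_, by omega, hk⟩⟩
  have hj2 := par_lt_two j
  by_contra hpj
  have hjq : par j = q := by omega
  have : j ∈ univ.filter fun i : Fin n => x i = true ∧ par i = q := by simp [hj, hjq]
  rw [hc, mem_singleton] at this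
  exact hjc this

/-- ★ THE TYPED RESIDUAL `Pred32Law n`: the predecessor witness is correct on the odd-class inputs of parity split `(3,2)`.
Hand proof (g26 `num/Q-STRUCTURE.md`): the kernel vector is supported on the even arc between the two minority ones that holds
an even number of majority ones (plus an odd arc in the sub-case of two), sign bit `1` / `0`, three / two predecessors inside.
Numerically 0 violations on all C(n,5) inputs, `n = 10 … 18`; the split `(4,3)` (weight 7) is where the witness dies. -/
def Pred32Law (n : ℕ) : Prop :=
  ∀ x : Fin n → Bool, OddZeros x → (parCount x 0 = 3 ∧ parCount x 1 = 2) ∨ (parCount x 0 = 2 ∧ parCount x 1 = 3) →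
    Rel x (predAns x)

/-- the one-minority splits, packaged: parity `q` carries exactly one one, the other parity `2` or `4`. -/
theorem rel_of_parCount_eq_one (hn : Even n) (h3 : 3 ≤ n) {x : Fin n → Bool} (hx : OddZeros x) {q : ℕ} (hq : q < 2)
    (h1 : parCount x q = 1) (hk : parCount x ((q + 1) % 2) = 2 ∨ parCount x ((q + 1) % 2) = 4) : Rel x (predAns x) := by
  have hke : Even (parCount x ((q + 1) % 2)) := by
    rcases hk with e | e
    · rw [e]; exact ⟨1, rfl⟩
    · rw [e]; exact ⟨2, rfl⟩
  obtain ⟨c, hc⟩ := oneMinority_of_parCount_eq_one hn h3 hq h1 hke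
  rcases hk with e | e
  · exact hc.rel_of_two hx e
  · exact hc.rel_of_four hx e

/-- ★★ WEIGHT ≤ 3, UNCONDITIONALLY (even ring, `n ≥ 3`): the predecessor witness answers every odd-class input of weight `≤ 3`
correctly — splits `(1,0)`, `(3,0)` by the same-parity law, `(2,1)` by the unrolled-count law. -/
theorem predWPerfect_three (hn : Even n) (h3 : 3 ≤ n) : PredWPerfect n 3 := by
  intro x hx hw
  have hsum := parCount_add x; have hodd := wt_mod_two_of_oddZeros hn hx
  by_cases hz1 : parCount x 1 = 0
  · exact rel_predW_of_sameParity hn h3 hx (sameParity_of_parCount_eq_zero (q := 1) (by norm_num) hz1)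
  by_cases hz0 : parCount x 0 = 0
  · exact rel_predW_of_sameParity hn h3 hx (sameParity_of_parCount_eq_zero (q := 0) (by norm_num) hz0)
  by_cases h1 : parCount x 1 = 1
  · exact rel_of_parCount_eq_one hn h3 hx (q := 1) (by norm_num) h1 (Or.inl (by simp; omega))
  · have h0 : parCount x 0 = 1 := by omega
    exact rel_of_parCount_eq_one hn h3 hx (q := 0) (by norm_num) h0 (Or.inl (by simp; omega))

/-- ★★ WEIGHT ≤ 5 FROM THE `(3,2)` LAW: all other splits (`(1,0)`, `(3,0)`, `(5,0)`, `(2,1)`, `(4,1)`) are proved here. -/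
theorem predWPerfect_five_of_law32 (hn : Even n) (h3 : 3 ≤ n) (h32 : Pred32Law n) : PredWPerfect n 5 := by
  intro x hx hw
  have hsum := parCount_add x; have hodd := wt_mod_two_of_oddZeros hn hx
  by_cases hz1 : parCount x 1 = 0
  · exact rel_predW_of_sameParity hn h3 hx (sameParity_of_parCount_eq_zero (q := 1) (by norm_num) hz1)
  by_cases hz0 : parCount x 0 = 0
  · exact rel_predW_of_sameParity hn h3 hx (sameParity_of_parCount_eq_zero (q := 0) (by norm_num) hz0)
  by_cases h1 : parCount x 1 = 1
  · exact rel_of_parCount_eq_one hn h3 hx (q := 1) (by norm_num) h1 (by simp; omega)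
  by_cases h0 : parCount x 0 = 1
  · exact rel_of_parCount_eq_one hn h3 hx (q := 0) (by norm_num) h0 (by simp; omega)
  · exact h32 x hx (by omega)

/-- ★★★ THE DEGREE-2 LIGHT DIAL DOES NOT START AT WEIGHT 3 (THEOREM): `¬ LightFail 2 3` — at every even length `≥ 4` the explicit
quadratic predecessor witness is perfect on all odd-class inputs of weight `≤ 3`; one step above the interpolation floor
`not_lightFail_of_le` (`w ≤ 2`), and the first formally decided cell of the census ask K-LD1 beyond it. -/
theorem not_lightFail_two_three : ¬ LightFail 2 3 :=
  not_lightFail_of_predWPerfect (n₁ := 4) fun n hn h4 => predWPerfect_three hn (by omega)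

/-- every even length `≥ 4` lies outside `lightLosing 2 3`. -/
theorem not_mem_lightLosing_two_three (hn : Even n) (h4 : 4 ≤ n) : n ∉ lightLosing 2 3 :=
  not_mem_lightLosing_of_predWPerfect (predWPerfect_three hn (by omega))

/-- ★★ THE KERNEL NEGATIVE LEMMA TO WEIGHT 5, ASSEMBLED: the `(3,2)` law at all even lengths `≥ 10` refutes `LightFail 2 5` — the law-bet
piece of NODE «LightDial» must be read at `w ≥ 7` (numerically the threshold IS 7: g26 `num/Q-STRUCTURE.md`). -/
theorem not_lightFail_two_five_of_law32 (h : ∀ n, Even n → 10 ≤ n → Pred32Law n) : ¬ LightFail 2 5 :=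
  not_lightFail_of_predWPerfect (n₁ := 10) fun n hn h10 => predWPerfect_five_of_law32 hn (by omega) (h n hn h10)

/-- monotonicity bookkeeping: the same hypothesis refutes `LightFail 2 w` for every `w ≤ 5`. -/
theorem not_lightFail_two_of_le_five (h : ∀ n, Even n → 10 ≤ n → Pred32Law n) {w : ℕ} (hw : w ≤ 5) : ¬ LightFail 2 w :=
  fun hf => not_lightFail_two_five_of_law32 h (lightFail_mono hw hf)

end Summit.QuantumAdvantage.QuantumAdvantage.Theorems.LightDial
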